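import Summits.ResolutionOfSingularities.ResolutionOfSingularities.Theorems.EquisingularLiftEquisingularLiftNatTowerBPairRoundCore
import Summits.ResolutionOfSingularities.ResolutionOfSingularities.Theorems.EquisingularLiftEquisingularLiftNatTowerBPrimeRoundOfFact
import Literature.AlgebraicGeometry.Resolution.HypersurfaceRestriction
import Literature.AlgebraicGeometry.Resolution.SNCStrataSmooth
import HarnessLib

/-!
# [OURS · L1 W4.5(b) · EL♮(3) · T23-A″] THE PAIR ROUND ON `Tower.InvB` AT THE DATUM «`V(𝓔)` IS `O`-FLAT»: the `hPair` discharger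
# `Tower.hPair_of_coneWitness` and the round-of-fact″ `Tower.invB_pairRound_of_fact` over the core″ `Tower.invB_pairRoundCore` (p615801)

res-L1-w45b-stub-4 g11 (T23-A / A′ / A″ engine owner; engine word `L/res-L1-w45b-stub-4/T23Adprime-ENGINE-WORD.md` 16d03a46d50c8ccd §3, desk R20).
Crux EL♮(3) = stmt-ResolutionOfSingularities-20148 (parent stmt-…-20038); rung target″ `stub_elnat_defTowerBDoublePrimePointResolutionThree` (lead-2's Defs″,
30th registration). OURS; NOT a statement of any manuscript ([Hironaka2017] is a candidate under adjudication, nothing of it is asserted); AI-written, weaker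
than expert review. DEF-FREE; no `sorry`; standard axioms. `--supports stmt-ResolutionOfSingularities-20148 --as helper`.

WHAT. (1) `Tower.hPair_of_coneWitness` = the binder `hPair` of the core″ at the engine datum `FE := «V(·) is O-flat»`, for a host `H` and a witness `W`
crossing REDUCEDLY along the full centre `Z` (`ConeWitness G H hH W Z hZ`, `Z̃` regular, `Z̃` a curve at its closed points `hZdim`): exact trace by `comap_sup`
+ the witness clause; the CODIMENSION binder `hWdim` at CLOSED crossing points by `hZdim` + T-DIM `ringKrullDim_stalk_eq_succ_of_chain` (dim 𝒪_{X,x} = 4)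
+ `ringKrullDim_stalk_subscheme`; regularity / flatness of `V(𝓗 ⊔ 𝓦)` by the two (A″-1)/(A″-2) v2 bricks of res-L1-w45b-stub-2 (`…NatBoundaryWitnessedCentre`,
shape fixed by the engine word l.79433 — taken here as the two NAMED INPUTS `hA1`/`hA2` of exactly that shape, supplied by name in V10″); 2-frames by
`hFrame_of_ringKrullDim_redSub`; the two Cartier clauses by `isEffectiveCartier_comap_subschemeι_of_frames` + `comap_sup`/`comap_subschemeι_self`.
(2) `Tower.invB_pairRound_of_fact` = res-L1-w45b-stub-2's `Tower.invB_embRound_of_fact_anyPrime` (…NatTowerBPrimeRoundOfFact) ADAPTED: host menu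
`(H = E ∧ KH = K) ∨ (H ∈ Es ∧ KH = ∅)`, witness `W ∈ E :: Es`, NO (T-k) fact / `DirStepUnobs` / host-regularity; list clause = `RoundTransportOKDoublePrime` UNFOLDED
(`F = H ∨ F = W ∨ Disjoint Z F ∨ (T1) ∧ (T2)`; lead-2's Defs″ land independently, V10″ bridges by `Iff.rfl`); shadow / birth / iso / strict-transform / (A′-1) / (A′-3)′
dischargers VERBATIM; core = `Tower.invB_pairRoundCore`. [cite: GortzWedhorn2020, (13.19) and Prop. 13.91] [cite: Matsumura1987, Thm. 15.1 and §14]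
-/

set_option linter.dupNamespace false -- mandated namespace `Summit.<Summit>.<Problem>` of this single-conjunct summit
set_option linter.overlappingInstances false -- signatures carry `[IsDomain O] [IsDiscreteValuationRing O]`

noncomputable section

open CategoryTheory CategoryTheory.Limits AlgebraicGeometry TopologicalSpace Topology IsLocalRing
open Literature.AlgebraicGeometry.Resolution
open AlgebraicGeometry.Scheme.IdealSheafData
open Summit.ResolutionOfSingularities.ResolutionOfSingularities.Theses.EquisingularLift.Split
open Summit.ResolutionOfSingularities.ResolutionOfSingularities.Cruxes.EquisingularLift.StrataSplit

namespace Summit.ResolutionOfSingularities.ResolutionOfSingularities.Cruxes.EquisingularLiftNat.Sections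

section Fact

variable (O : Type) [CommRing O] [IsDomain O] [IsDiscreteValuationRing O] (k : Type) [Field k]
    (θ : O →+* k) (hθ : Function.Surjective θ)
    (P : Scheme.{0}) [IsIntegral P] (q : P ⟶ Spec (.of O)) [IsProper q] [SmoothOfRelativeDimension 3 q] (Y : Set P)
    (hYsp : Y ⊆ q ⁻¹' {IsLocalRing.closedPoint O}) (hYirr : IsIrreducible Y) (hYcl : IsClosed Y)
    (hPnoeth : IsLocallyNoetherian P) (hPreg : Scheme.IsRegular P)
    (Ch : ∀ X' : Scheme.{0}, (X' ⟶ P) → Set X' → Prop)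
    (hChStep : ∀ (X' X'' : Scheme.{0}) (σ' : X' ⟶ P) (S' : Set X') (C : X'.IdealSheafData) (τ : X'' ⟶ X'),
      Ch X' σ' S' → IsBlowup τ C → Scheme.IsRegular C.subscheme → Flat (C.subschemeι ≫ σ' ≫ q) →
      σ' '' (C.support : Set X') ⊆ {y | ¬ IsGenericPoint y Y} → (C.support : Set X') ∩ (σ' ≫ q) ⁻¹' {IsLocalRing.closedPoint O} ⊆ S' →
      Ch X'' (τ ≫ σ') (closure (τ ⁻¹' (S' \ (C.support : Set X')))))
    (hChSplit : ∀ (X' : Scheme.{0}) (σ' : X' ⟶ P) (S' : Set X'), Ch X' σ' S' → Chain P Y X' σ' S')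

include hθ hYsp hYirr hYcl hPnoeth hPreg hChStep hChSplit

/-! The shapes of res-L1-w45b-stub-2's (A″-1)/(A″-2) v2 bricks `isRegular_subscheme_sup_of_trace_crossing` / `flat_subschemeι_sup_of_trace_crossing`
(engine word l.79433 (a)(b)): two stalkwise-principal models with reduced traces `E`, `F` crossing REDUCEDLY (`𝓘⟨E⟩ ⊔ 𝓘⟨F⟩ = 𝓘⟨E ∩ F⟩`) along a regular
`(E ∩ F)~` of CODIMENSION 2 in the special fibre at its closed points have a regular, `O`-flat intersection `V(𝓔 ⊔ 𝓕)`. They enter this file as the two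
section hypotheses `hA1` / `hA2` (no import of the brick's file; V10″ supplies the two theorems by name). -/
variable
    (hA1 : ∀ {G X : Scheme.{0}} [IsLocallyNoetherian X] {σ : X ⟶ P} {jG : G ⟶ X} {tG : G ⟶ Spec (.of k)} {𝓔 𝓕 : X.IdealSheafData}
      {E F : Set G} {hE : IsClosed E} {hF : IsClosed F},
      Scheme.IsRegular X → IsPullback jG tG (σ ≫ q) (Spec.map (CommRingCat.ofHom θ)) → Function.Surjective θ → IsProper (σ ≫ q) →
      𝓔.comap jG = vanishingIdeal ⟨E, hE⟩ → (∀ x : X, (stalkIdeal 𝓔 x).IsPrincipal) →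
      𝓕.comap jG = vanishingIdeal ⟨F, hF⟩ → (∀ x : X, (stalkIdeal 𝓕 x).IsPrincipal) →
      vanishingIdeal ⟨E, hE⟩ ⊔ vanishingIdeal ⟨F, hF⟩ = vanishingIdeal (⟨E ∩ F, hE.inter hF⟩ : Closeds G) →
      (∀ z : ↥(vanishingIdeal (⟨E ∩ F, hE.inter hF⟩ : Closeds G)).subscheme,
        IsRegularLocalRing ((vanishingIdeal (⟨E ∩ F, hE.inter hF⟩ : Closeds G)).subscheme.presheaf.stalk z)) →
      (∀ g ∈ E ∩ F, IsClosed ({g} : Set G) →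
        ringKrullDim (G.presheaf.stalk g ⧸ stalkIdeal (vanishingIdeal (⟨E ∩ F, hE.inter hF⟩ : Closeds G)) g) + 3 =
          ringKrullDim (X.presheaf.stalk (jG g))) →
      Scheme.IsRegular (𝓔 ⊔ 𝓕).subscheme)
    (hA2 : ∀ {G X : Scheme.{0}} [IsLocallyNoetherian X] {σ : X ⟶ P} {jG : G ⟶ X} {tG : G ⟶ Spec (.of k)} {𝓔 𝓕 : X.IdealSheafData}
      {E F : Set G} {hE : IsClosed E} {hF : IsClosed F},
      Scheme.IsRegular X → IsPullback jG tG (σ ≫ q) (Spec.map (CommRingCat.ofHom θ)) → Function.Surjective θ → IsProper (σ ≫ q) →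
      𝓔.comap jG = vanishingIdeal ⟨E, hE⟩ → (∀ x : X, (stalkIdeal 𝓔 x).IsPrincipal) →
      𝓕.comap jG = vanishingIdeal ⟨F, hF⟩ → (∀ x : X, (stalkIdeal 𝓕 x).IsPrincipal) →
      vanishingIdeal ⟨E, hE⟩ ⊔ vanishingIdeal ⟨F, hF⟩ = vanishingIdeal (⟨E ∩ F, hE.inter hF⟩ : Closeds G) →
      (∀ z : ↥(vanishingIdeal (⟨E ∩ F, hE.inter hF⟩ : Closeds G)).subscheme,
        IsRegularLocalRing ((vanishingIdeal (⟨E ∩ F, hE.inter hF⟩ : Closeds G)).subscheme.presheaf.stalk z)) →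
      (∀ g ∈ E ∩ F, IsClosed ({g} : Set G) →
        ringKrullDim (G.presheaf.stalk g ⧸ stalkIdeal (vanishingIdeal (⟨E ∩ F, hE.inter hF⟩ : Closeds G)) g) + 3 =
          ringKrullDim (X.presheaf.stalk (jG g))) →
      Flat ((𝓔 ⊔ 𝓕).subschemeι ≫ σ ≫ q))

include hA1 hA2

omit hYsp hChStep in
set_option maxHeartbeats 800000 in
/-- **`Tower.hPair_of_coneWitness` — the binder `hPair` of the core″ `Tower.invB_pairRoundCore` at the engine datum `FE`** (module docstring (1)): for a host
`H` and a witness `W` (both `¬ ⊇ T`) crossing reducedly along the full centre `Z` (`ConeWitness G H hH W Z hZ`) with `Z̃` regular and a curve at its closed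
points, the models `𝓔`, `𝓦` satisfy: `(𝓔 ⊔ 𝓦)·𝒪_G = 𝓘⟨Z⟩`, `V(𝓔 ⊔ 𝓦)` is `O`-flat and regular, `𝓦|_{V(𝓔)}` and `𝓔|_{V(𝓦)}` are effective Cartier, and the
stalks of `𝓔 ⊔ 𝓦` are generated by quasi-regular pairs. [cite: Matsumura1987, Thm. 15.1 and §14] [OURS · L1 W4.5b · T23-A″ engine] toward
`stub_elnat_defTowerBDoublePrimePointResolutionThree`; NOT a statement of the manuscript. -/
theorem Tower.hPair_of_coneWitness :
    ∀ {F₉ : Scheme.{0}} (Z₉ : Set F₉) (hZ₉ : IsClosed Z₉) {F₁₀ : Scheme.{0}} (υ' : F₁₀ ⟶ F₉)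
    (G : Scheme.{0}) (γ : G ⟶ F₁₀) (T H : Set G) (hH : IsClosed H) (Z : Set G) (hZ : IsClosed Z) (W : Set G) (hW : IsClosed W),
    ¬ T ⊆ H → ConeWitness G H hH W Z hZ →
    (∀ x : redSub G Z hZ, IsRegularLocalRing ((redSub G Z hZ).presheaf.stalk x)) →
    (∀ z : ↥(redSub G Z hZ), IsClosed ({z} : Set ↥(redSub G Z hZ)) → ringKrullDim ((redSub G Z hZ).presheaf.stalk z) = ((1 : ℕ) : WithBot ℕ∞)) →
    ∀ (X : Scheme.{0}) (σ : X ⟶ P) (S : Set X) (jG : G ⟶ X) (tG : G ⟶ Spec (.of k)),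
      Ch X σ S → IsIntegral X → IsLocallyNoetherian X → Scheme.IsRegular X → IsDominant (σ ≫ q) →
      IsPullback jG tG (σ ≫ q) (Spec.map (CommRingCat.ofHom θ)) → jG '' T = S →
    ∀ (𝓔 𝓦 : X.IdealSheafData),
      𝓔.comap jG = vanishingIdeal ⟨H, hH⟩ → (∀ z : X, (stalkIdeal 𝓔 z).IsPrincipal) → Scheme.IsRegular 𝓔.subscheme →
      σ '' (𝓔.support : Set X) ⊆ {p : P | ¬ IsGenericPoint p Y} →
      (fun _ _ _ _ _ _ _ _ _ σ _ 𝓔 => Flat (𝓔.subschemeι ≫ σ ≫ q)) F₉ Z₉ hZ₉ F₁₀ υ' G γ H X σ jG 𝓔 →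
      𝓦.comap jG = vanishingIdeal ⟨W, hW⟩ → (∀ z : X, (stalkIdeal 𝓦 z).IsPrincipal) → Scheme.IsRegular 𝓦.subscheme →
      σ '' (𝓦.support : Set X) ⊆ {p : P | ¬ IsGenericPoint p Y} →
      (fun _ _ _ _ _ _ _ _ _ σ _ 𝓔 => Flat (𝓔.subschemeι ≫ σ ≫ q)) F₉ Z₉ hZ₉ F₁₀ υ' G γ W X σ jG 𝓦 → ¬ T ⊆ W →
      (𝓔 ⊔ 𝓦).comap jG = vanishingIdeal ⟨Z, hZ⟩ ∧ Flat ((𝓔 ⊔ 𝓦).subschemeι ≫ σ ≫ q) ∧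
        Scheme.IsRegular (𝓔 ⊔ 𝓦).subscheme ∧ IsEffectiveCartier (𝓦.comap 𝓔.subschemeι) ∧ IsEffectiveCartier (𝓔.comap 𝓦.subschemeι) ∧
        (∀ x ∈ (𝓔 ⊔ 𝓦).support, ∃ c : Fin 2 → X.presheaf.stalk x,
          Ideal.span (Set.range c) = stalkIdeal (𝓔 ⊔ 𝓦) x ∧ IsQuasiRegular c) := by
  intro F₉ Z₉ hZ₉ F₁₀ υ' G γ T H hH Z hZ W hW hTH hpair hZreg hZdim X σ S jG tG hCh hXint hXnoeth hXreg hdom hsq hTS 𝓔 𝓦 he_i he_ii he_iii _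
    hFE_E hw_i hw_ii hw_iii _ hFE_W hTW
  haveI := hXint
  haveI := hXnoeth
  obtain ⟨-, -, hσ⟩ := chain_isRegular P Y X σ S (hChSplit _ _ _ hCh) hPnoeth hPreg
  haveI := hσ
  haveI : IsProper (σ ≫ q) := inferInstance
  haveI : IsClosedImmersion (Spec.map (CommRingCat.ofHom θ)) := IsClosedImmersion.spec_of_surjective _ hθ
  haveI hjci : IsClosedImmersion jG := MorphismProperty.IsStableUnderBaseChange.of_isPullback hsq.flip inferInstance
  have hflatE : Flat (𝓔.subschemeι ≫ σ ≫ q) := hFE_E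
  have hflatW : Flat (𝓦.subschemeι ≫ σ ≫ q) := hFE_W
  -- the witness downstairs: `Z = H ∩ W` with the REDUCED crossing `𝓘⟨H⟩ ⊔ 𝓘⟨W⟩ = 𝓘⟨Z⟩`
  obtain ⟨hZeq, hwit⟩ := hpair
  have hWc : closure W = W := hW.closure_eq
  have hZeq' : Z = H ∩ W := by rw [hZeq, hWc]
  have hcW : (⟨closure W, isClosed_closure⟩ : Closeds G) = ⟨W, hW⟩ := Closeds.ext hWc
  have hcZ : (⟨Z, hZ⟩ : Closeds G) = ⟨H ∩ W, hH.inter hW⟩ := Closeds.ext hZeq'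
  have hW1 : vanishingIdeal ⟨H, hH⟩ ⊔ vanishingIdeal ⟨W, hW⟩ = vanishingIdeal (⟨H ∩ W, hH.inter hW⟩ : Closeds G) := by
    rw [← hcW, ← hcZ]; exact hwit
  -- (c1) the exact trace
  have hc1 : (𝓔 ⊔ 𝓦).comap jG = vanishingIdeal ⟨Z, hZ⟩ := by
    rw [Scheme.IdealSheafData.comap_sup, he_i, hw_i, hW1, hcZ]
  -- the codimension binder at the CLOSED crossing points: `dim 𝒪_{Z̃,g} = 1` (hZdim) and `dim 𝒪_{X, jG g} = 4` (T-DIM)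
  have hξ : IsGenericPoint hYirr.genericPoint Y := hYirr.isGenericPoint_genericPoint hYcl
  have hWdim : ∀ g ∈ H ∩ W, IsClosed ({g} : Set G) →
      ringKrullDim (G.presheaf.stalk g ⧸ stalkIdeal (vanishingIdeal (⟨H ∩ W, hH.inter hW⟩ : Closeds G)) g) + 3 =
        ringKrullDim (X.presheaf.stalk (jG g)) := by
    intro g hg hgc
    rw [← hcZ]
    have hgZ : g ∈ Z := hZeq' ▸ hg
    -- `g` as a point of `Z̃`
    have hgr : g ∈ Set.range (redSubι G Z hZ) := by
      change g ∈ Set.range (vanishingIdeal (⟨Z, hZ⟩ : Closeds G)).subschemeι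
      rw [Scheme.IdealSheafData.range_subschemeι, Scheme.IdealSheafData.coe_support_vanishingIdeal]; exact hgZ
    obtain ⟨z, hz⟩ := hgr
    have hzc : IsClosed ({z} : Set ↥(redSub G Z hZ)) := by
      have h1 : ({z} : Set ↥(redSub G Z hZ)) = (redSubι G Z hZ) ⁻¹' {g} := by
        ext z'
        simp only [Set.mem_singleton_iff, Set.mem_preimage]
        constructor
        · rintro rfl; exact hz
        · intro h; exact (redSubι G Z hZ).isClosedEmbedding.injective (h.trans hz.symm)
      rw [h1]; exact hgc.preimage (redSubι G Z hZ).continuous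
    have h1 : ringKrullDim (G.presheaf.stalk g ⧸ stalkIdeal (vanishingIdeal (⟨Z, hZ⟩ : Closeds G)) g) = ((1 : ℕ) : WithBot ℕ∞) := by
      rw [← hz, ← Literature.AlgebraicGeometry.Resolution.ringKrullDim_stalk_subscheme]; exact hZdim z hzc
    -- `jG g` is a closed point over the closed point of `Spec O`
    have hjc : IsClosed ({jG g} : Set X) := by
      have := jG.isClosedMap _ hgc; rwa [Set.image_singleton] at this
    have hjs : (σ ≫ q).base (jG g) = closedPoint O := by
      have h2 : jG g ∈ Set.range jG := ⟨g, rfl⟩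
      rw [range_eq_preimage_of_isPullback hsq, range_specMap_of_surjective_of_field θ hθ] at h2
      exact h2
    have h4 : ringKrullDim (X.presheaf.stalk (jG g)) = ((3 + 1 : ℕ) : WithBot ℕ∞) :=
      ringKrullDim_stalk_eq_succ_of_chain q 3 hξ (hChSplit _ _ _ hCh) hjc hjs
    rw [h1, h4]; rfl
  have hW2 : ∀ z : ↥(vanishingIdeal (⟨H ∩ W, hH.inter hW⟩ : Closeds G)).subscheme,
      IsRegularLocalRing ((vanishingIdeal (⟨H ∩ W, hH.inter hW⟩ : Closeds G)).subscheme.presheaf.stalk z) := by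
    rw [← hcZ]; exact hZreg
  -- (c3), (c2): regular and flat by the two bricks
  have hc3 : Scheme.IsRegular (𝓔 ⊔ 𝓦).subscheme := hA1 hXreg hsq hθ inferInstance he_i he_ii hw_i hw_ii hW1 hW2 hWdim
  have hc2 : Flat ((𝓔 ⊔ 𝓦).subschemeι ≫ σ ≫ q) := hA2 hXreg hsq hθ inferInstance he_i he_ii hw_i hw_ii hW1 hW2 hWdim
  -- (c5) the 2-frames
  have hc5 : ∀ x ∈ (𝓔 ⊔ 𝓦).support, ∃ c : Fin 2 → X.presheaf.stalk x,
      Ideal.span (Set.range c) = stalkIdeal (𝓔 ⊔ 𝓦) x ∧ IsQuasiRegular c :=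
    hFrame_of_ringKrullDim_redSub O k θ hθ P q Y hYirr hYcl hPnoeth hPreg Ch hChSplit T Z hZ hZdim X σ S jG tG (𝓔 ⊔ 𝓦) hCh hXint hXnoeth
      hXreg hdom hsq hTS hc1 hc2 hc3
  -- (c4), (c4′): both members are Cartier and cut the centre as a Cartier divisor on the other
  have hne : ∀ (𝓐 : X.IdealSheafData) (A : Set G) (hA : IsClosed A), 𝓐.comap jG = vanishingIdeal ⟨A, hA⟩ → ¬ T ⊆ A → 𝓐 ≠ ⊥ := by
    intro 𝓐 A hA hAi hTA h0
    apply hTA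
    have h2 : A = Set.univ := by
      have h3 : (((vanishingIdeal ⟨A, hA⟩ : G.IdealSheafData)).support : Set G) = ((⊤ : Closeds G) : Set G) := by
        rw [← hAi, h0, Scheme.IdealSheafData.comap_bot, Scheme.IdealSheafData.support_bot]
      rwa [Scheme.IdealSheafData.coe_support_vanishingIdeal, Closeds.coe_top] at h3
    rw [h2]; exact Set.subset_univ _
  have h𝓔cart : IsEffectiveCartier 𝓔 := isEffectiveCartier_of_isPrincipal_stalkIdeal_of_ne_bot he_ii (hne 𝓔 H hH he_i hTH)
  have h𝓦cart : IsEffectiveCartier 𝓦 := isEffectiveCartier_of_isPrincipal_stalkIdeal_of_ne_bot hw_ii (hne 𝓦 W hW hw_i hTW)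
  have hc4 : IsEffectiveCartier (𝓦.comap 𝓔.subschemeι) := by
    have h := isEffectiveCartier_comap_subschemeι_of_frames hXreg 𝓔 (𝓔 ⊔ 𝓦) le_sup_left h𝓔cart he_iii hc5
    rwa [Scheme.IdealSheafData.comap_sup, Literature.AlgebraicGeometry.Resolution.comap_subschemeι_self, bot_sup_eq] at h
  have hc4' : IsEffectiveCartier (𝓔.comap 𝓦.subschemeι) := by
    have h := isEffectiveCartier_comap_subschemeι_of_frames hXreg 𝓦 (𝓔 ⊔ 𝓦) le_sup_right h𝓦cart hw_iii hc5
    rwa [Scheme.IdealSheafData.comap_sup, Literature.AlgebraicGeometry.Resolution.comap_subschemeι_self, sup_bot_eq] at h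
  exact ⟨hc1, hc2, hc3, hc4, hc4', hc5⟩

omit hYsp in
set_option maxHeartbeats 800000 in
/-- **The PAIR round of `TowerRoundBDoublePrime` on `Tower.InvB` at the datum «`V(𝓔)` is `O`-flat», BOTH host menus** (module docstring (2)): host
`H ∈ {E} ∪ Es` (shadow `KH ∈ {K, ∅}` accordingly), witness `W ∈ E :: Es` with `ConeWitness G H hH W Z hZ`, `Z̃` regular, full; the list transported by
`F = H ∨ F = W ∨ Disjoint Z F ∨ (T1) ∧ (T2)` (= lead-2's `RoundTransportOKDoublePrime` unfolded). Every stand-in of the core″ discharged at `FE` except the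
two (A″-1)/(A″-2) v2 bricks, which are the named inputs `hA1`/`hA2`. [OURS · L1 W4.5b · T23-A″ engine] toward `stub_elnat_defTowerBDoublePrimePointResolutionThree`;
NOT a statement of the manuscript. -/
theorem Tower.invB_pairRound_of_fact :
    ∀ {F₉ : Scheme.{0}} (Z₉ : Set F₉) (hZ₉ : IsClosed Z₉) {F₁₀ : Scheme.{0}} (υ' : F₁₀ ⟶ F₉)
    (G G' : Scheme.{0}) (γ : G ⟶ F₁₀) (T E : Set G) (Es : List (Set G)) (K H KH : Set G) (hH : IsClosed H) (Z : Set G) (hZ : IsClosed Z)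
    (W : Set G) (hW : IsClosed W) (υ₂ : G' ⟶ G) (K' E' : Set G') (Es' : List (Set G')),
    (Tower.InvB O k θ P q Y Ch (fun _ _ _ _ _ _ _ _ _ σ _ 𝓔 => Flat (𝓔.subschemeι ≫ σ ≫ q)) F₉ Z₉ hZ₉ F₁₀ υ' G γ T E Es K ∧
      IsClosed K ∧ K ⊆ closure (K \ E) ∧ K ≠ Set.univ) →
    ((H = E ∧ KH = K) ∨ (H ∈ Es ∧ KH = ∅)) → W ∈ E :: Es → ConeWitness G H hH W Z hZ →
    Z ⊆ T → Z.Nonempty → TowerFull F₉ F₁₀ υ' Z₉ hZ₉ G γ Z hZ →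
    (∀ x : redSub G Z hZ, IsRegularLocalRing ((redSub G Z hZ).presheaf.stalk x)) →
    (∀ z : ↥(redSub G Z hZ), IsClosed ({z} : Set ↥(redSub G Z hZ)) → ringKrullDim ((redSub G Z hZ).presheaf.stalk z) = ((1 : ℕ) : WithBot ℕ∞)) →
    IsBlowup υ₂ (vanishingIdeal (⟨Z, hZ⟩ : Closeds G)) →
    (K' = ∅ ∨ (closure (Z \ closure KH) = Z ∧ K' = closure (υ₂ ⁻¹' (KH \ Z)))) →
    (E' = υ₂ ⁻¹' Z ∨ E' = closure (υ₂ ⁻¹' (H \ Z))) →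
    (∀ F' ∈ Es', ∃ F ∈ E :: Es,
      (F = H ∨ F = W ∨ Disjoint Z F ∨
        ∃ hF : IsClosed F,
          (∀ g ∈ Z ∩ F, stalkIdeal (vanishingIdeal (⟨Z, hZ⟩ : Closeds G)) g ⊔ stalkIdeal (vanishingIdeal (⟨F, hF⟩ : Closeds G)) g =
              maximalIdeal (G.presheaf.stalk g)) ∧
            ∀ g ∈ Z ∩ F, stalkIdeal (vanishingIdeal (⟨Z, hZ⟩ : Closeds G)) g ≠ maximalIdeal (G.presheaf.stalk g)) ∧
      F' = closure (υ₂ ⁻¹' (F \ Z))) →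
    (Tower.InvB O k θ P q Y Ch (fun _ _ _ _ _ _ _ _ _ σ _ 𝓔 => Flat (𝓔.subschemeι ≫ σ ≫ q)) F₉ Z₉ hZ₉ F₁₀ υ' G' (υ₂ ≫ γ) (closure (υ₂ ⁻¹' (T \ Z))) E' Es' K' ∧
      IsClosed K' ∧ K' ⊆ closure (K' \ E') ∧ K' ≠ Set.univ) := by
  intro F₉ Z₉ hZ₉ F₁₀ υ' G G' γ T E Es K H KH hH Z hZ W hW υ₂ K' E' Es' hI hhost hWmem hpair hZT hZne hfull hZreg hZdim hυ₂ hK' hE' hEs'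
  obtain ⟨hinv, hKcl, hKE, hKne⟩ := hI
  obtain ⟨hυ', hZinf, hGint, hTcl, hTirr, hEcl, hTE, hEsB, X, σ, S, jG, tG, hCh, hXint, hXnoeth, hXreg, hdom, hsq, hTS, hExc, hExcF⟩ := hinv
  haveI := hGint
  haveI := hXint
  haveI := hXnoeth
  have hZH : Z ⊆ H := fun z hz => by
    have h := hpair.1 ▸ hz
    exact h.1
  have hZsupp : ((vanishingIdeal (⟨Z, hZ⟩ : Closeds G) : G.IdealSheafData).support : Set G) = Z :=
    Scheme.IdealSheafData.coe_support_vanishingIdeal _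
  -- the candidates `E :: Es`, shadows forgotten
  have hCand : ∀ F ∈ E :: Es, ∃ hF : IsClosed F, ¬ T ⊆ F ∧
      Tower.Exc₃ O P q Y (fun _ _ _ _ _ _ _ _ _ σ _ 𝓔 => Flat (𝓔.subschemeι ≫ σ ≫ q)) Z₉ hZ₉ υ' G γ F hF ∅ X σ jG := by
    intro F hF
    rcases List.mem_cons.mp hF with rfl | hF
    · exact ⟨hEcl, hTE, Tower.exc₃_forgetShadow O P q Y _ (hExc hEcl)⟩
    · exact ⟨(hEsB F hF).1, (hEsB F hF).2, hExcF F hF (hEsB F hF).1⟩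
  -- the host's datum and bookkeeping
  have hhost' : ¬ T ⊆ H ∧ Tower.Exc₃ O P q Y (fun _ _ _ _ _ _ _ _ _ σ _ 𝓔 => Flat (𝓔.subschemeι ≫ σ ≫ q)) Z₉ hZ₉ υ' G γ H hH KH X σ jG ∧
      IsClosed KH ∧ KH ⊆ closure (KH \ H) ∧ KH ≠ Set.univ := by
    rcases hhost with ⟨rfl, rfl⟩ | ⟨hmem, rfl⟩
    · exact ⟨hTE, hExc hH, hKcl, hKE, hKne⟩
    · refine ⟨(hEsB H hmem).2, hExcF H hmem hH, isClosed_empty, Set.empty_subset _, ?_⟩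
      obtain ⟨z, _⟩ := hZne
      haveI : Nonempty G := ⟨z⟩
      exact Set.empty_ne_univ
  obtain ⟨hTH, hExcH, hKHcl, hKHE, hKHne⟩ := hhost'
  have hTZ : ¬ T ⊆ Z := fun h => hTH (h.trans hZH)
  -- the dischargers at `FE`
  have hP := Tower.hPair_of_coneWitness O k θ hθ P q Y hYirr hYcl hPnoeth hPreg Ch hChSplit hA1 hA2 Z₉ hZ₉ υ' G γ T H hH Z hZ W hW
    hTH hpair hZreg hZdim X σ S jG tG hCh hXint hXnoeth hXreg hdom hsq hTS
  have hS := Tower.hShadow_of_any O k θ hθ P q ‹IsProper q› Y hYirr hYcl hPnoeth hPreg Ch hChSplit ‹IsIntegral P› Z₉ hZ₉ υ' G G' γ T H KH hH Z hZ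
    υ₂ hυ₂
  have hSo := Tower.hShadowOld_of_any O k θ hθ P q ‹IsProper q› Y hYirr hYcl hPnoeth hPreg Ch hChSplit ‹IsIntegral P› Z₉ hZ₉ υ' G G' γ T H KH hH
    Z hZ υ₂ hυ₂
  have hBorn : ∀ (X : Scheme.{0}) (σ : X ⟶ P) (S : Set X) (jG : G ⟶ X) (tG : G ⟶ Spec (.of k)) (𝓔 𝒦₁ : X.IdealSheafData)
      (X'' : Scheme.{0}) (τ : X'' ⟶ X) (j₂ : G' ⟶ X'') (t₂ : G' ⟶ Spec (.of k)),
      Ch X σ S → IsIntegral X → IsLocallyNoetherian X → Scheme.IsRegular X → IsDominant (σ ≫ q) →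
      IsPullback jG tG (σ ≫ q) (Spec.map (CommRingCat.ofHom θ)) → jG '' T = S →
      (𝓔 ⊔ 𝒦₁).comap jG = vanishingIdeal ⟨Z, hZ⟩ → Flat ((𝓔 ⊔ 𝒦₁).subschemeι ≫ σ ≫ q) → Scheme.IsRegular (𝓔 ⊔ 𝒦₁).subscheme →
      Scheme.IsRegular 𝓔.subscheme → IsBlowup τ (𝓔 ⊔ 𝒦₁) → IsPullback j₂ t₂ ((τ ≫ σ) ≫ q) (Spec.map (CommRingCat.ofHom θ)) →
      j₂ ≫ τ = υ₂ ≫ jG →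
      Flat ((((𝓔 ⊔ 𝒦₁).comap τ)).subschemeι ≫ (τ ≫ σ) ≫ q) := by
    intro X σ S jG tG 𝓔 𝒦₁ X'' τ j₂ t₂ _ _ hXnoeth hXreg _ _ _ _ hc2 hc3 _ hτ _ _
    haveI := hXnoeth
    rw [Category.assoc]
    exact flat_exceptional_of_isBlowup_regularCentre O X X'' (σ ≫ q) (𝓔 ⊔ 𝒦₁) hXreg hc3 hc2 τ hτ
  have hIso : ∀ (G₀ G₀' : Scheme.{0}) (γ₀ : G₀ ⟶ F₁₀) (γ₀' : G₀' ⟶ F₁₀) (E₀ : Set G₀) (E₀' : Set G₀') (X₀ X₀'' : Scheme.{0})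
      (σ₀ : X₀ ⟶ P) (j₀ : G₀ ⟶ X₀) (j₀' : G₀' ⟶ X₀'') (𝓔₀ : X₀.IdealSheafData) (𝓔₀' : X₀''.IdealSheafData) (τ₀ : X₀'' ⟶ X₀),
      (∃ e : 𝓔₀'.subscheme ≅ 𝓔₀.subscheme, e.hom ≫ 𝓔₀.subschemeι = 𝓔₀'.subschemeι ≫ τ₀) →
      (fun _ _ _ _ _ _ _ _ _ σ _ 𝓔 => Flat (𝓔.subschemeι ≫ σ ≫ q)) F₉ Z₉ hZ₉ F₁₀ υ' G₀ γ₀ E₀ X₀ σ₀ j₀ 𝓔₀ →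
      (fun _ _ _ _ _ _ _ _ _ σ _ 𝓔 => Flat (𝓔.subschemeι ≫ σ ≫ q)) F₉ Z₉ hZ₉ F₁₀ υ' G₀' γ₀' E₀' X₀'' (τ₀ ≫ σ₀) j₀' 𝓔₀' := by
    intro G₀ G₀' γ₀ γ₀' E₀ E₀' X₀ X₀'' σ₀ j₀ j₀' 𝓔₀ 𝓔₀' τ₀ he hflat
    obtain ⟨e, he⟩ := he
    have hflat' : Flat (𝓔₀.subschemeι ≫ σ₀ ≫ q) := hflat
    have heq : 𝓔₀'.subschemeι ≫ (τ₀ ≫ σ₀) ≫ q = e.hom ≫ 𝓔₀.subschemeι ≫ σ₀ ≫ q := by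
      rw [← Category.assoc e.hom, he]; simp only [Category.assoc]
    show Flat (𝓔₀'.subschemeι ≫ (τ₀ ≫ σ₀) ≫ q)
    rw [heq]
    infer_instance
  -- T23-A′: the strict-transform transport of the datum `FE` (res-L1-w45b-stub-2's T-STFLAT-GEN)
  have hRuledSt : ∀ (G₀ G₀' : Scheme.{0}) (γ₀ : G₀ ⟶ F₁₀) (γ₀' : G₀' ⟶ F₁₀) (E₀ : Set G₀) (E₀' : Set G₀') (X₀ X₀'' : Scheme.{0})
      (σ₀ : X₀ ⟶ P) (j₀ : G₀ ⟶ X₀) (j₀' : G₀' ⟶ X₀'') (𝓔₀ C₀ : X₀.IdealSheafData) (τ₀ : X₀'' ⟶ X₀),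
      IsBlowup τ₀ C₀ → IsLocallyNoetherian X₀ → IsLocallyNoetherian X₀'' →
      (fun _ _ _ _ _ _ _ _ _ σ _ 𝓔 => Flat (𝓔.subschemeι ≫ σ ≫ q)) F₉ Z₉ hZ₉ F₁₀ υ' G₀ γ₀ E₀ X₀ σ₀ j₀ 𝓔₀ →
      (fun _ _ _ _ _ _ _ _ _ σ _ 𝓔 => Flat (𝓔.subschemeι ≫ σ ≫ q)) F₉ Z₉ hZ₉ F₁₀ υ' G₀' γ₀' E₀' X₀'' (τ₀ ≫ σ₀) j₀'
        (strictTransformIdeal τ₀ C₀ 𝓔₀) := by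
    intro G₀ G₀' γ₀ γ₀' E₀ E₀' X₀ X₀'' σ₀ j₀ j₀' 𝓔₀ C₀ τ₀ hτ₀ hX₀ hX₀'' hflat
    haveI := hX₀
    haveI := hX₀''
    have hflat' : Flat (𝓔₀.subschemeι ≫ σ₀ ≫ q) := hflat
    show Flat ((strictTransformIdeal τ₀ C₀ 𝓔₀).subschemeι ≫ (τ₀ ≫ σ₀) ≫ q)
    exact flat_strictTransform_subschemeι_comp_stage O σ₀ q τ₀ C₀ hτ₀ 𝓔₀ hflat'
  -- T23-A′: the third transport alternative = the stalkwise (T1) ∧ (T2) of `RoundTransportOKPrime`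
  let X3 : Set G → Prop := fun F => ∃ hF : IsClosed F,
    (∀ g ∈ Z ∩ F, stalkIdeal (vanishingIdeal (⟨Z, hZ⟩ : Closeds G)) g ⊔ stalkIdeal (vanishingIdeal (⟨F, hF⟩ : Closeds G)) g =
        maximalIdeal (G.presheaf.stalk g)) ∧
      ∀ g ∈ Z ∩ F, stalkIdeal (vanishingIdeal (⟨Z, hZ⟩ : Closeds G)) g ≠ maximalIdeal (G.presheaf.stalk g)
  have hEs'' : ∀ F' ∈ Es', ∃ F ∈ E :: Es, (F = H ∨ F = W ∨ Disjoint Z F ∨ X3 F) ∧ F' = closure (υ₂ ⁻¹' (F \ Z)) := by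
    intro F' hF'
    obtain ⟨F, hF, hok⟩ := hEs' F' hF'
    exact ⟨F, hF, hok⟩
  -- T23-A′ (A′-1): snc of a transversally crossed member with the centre (res-L1-w45b-lead-2 p608670)
  have hSNC : ∀ (C 𝓕 : X.IdealSheafData) (F : Set G) (hF : IsClosed F), X3 F → IsProper (σ ≫ q) →
      C.comap jG = vanishingIdeal ⟨Z, hZ⟩ → Flat (C.subschemeι ≫ σ ≫ q) → Scheme.IsRegular C.subscheme →
      𝓕.comap jG = vanishingIdeal ⟨F, hF⟩ → (∀ z : X, (stalkIdeal 𝓕 z).IsPrincipal) → Scheme.IsRegular 𝓕.subscheme →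
      σ '' (𝓕.support : Set X) ⊆ {p : P | ¬ IsGenericPoint p Y} →
      (fun _ _ _ _ _ _ _ _ _ σ _ 𝓔 => Flat (𝓔.subschemeι ≫ σ ≫ q)) F₉ Z₉ hZ₉ F₁₀ υ' G γ F X σ jG 𝓕 → ¬ T ⊆ F →
      HasSNCWith [𝓕] C := by
    intro C 𝓕 F hF hX3 hprop hC _ hCreg hF1 hF2 hF3 _ _ hTF
    obtain ⟨hF', hT1, hT2⟩ := hX3
    haveI := hprop
    have h𝓕0 : 𝓕 ≠ ⊥ := by
      rintro rfl
      apply hTF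
      have h1 : (vanishingIdeal (⟨F, hF⟩ : Closeds G) : G.IdealSheafData) = ⊥ := by
        rw [← hF1, Scheme.IdealSheafData.comap_bot]
      have h2 : ((vanishingIdeal (⟨F, hF⟩ : Closeds G) : G.IdealSheafData).support : Set G) = Set.univ := by
        rw [h1, Scheme.IdealSheafData.support_bot]; rfl
      rw [Scheme.IdealSheafData.coe_support_vanishingIdeal] at h2
      change F = Set.univ at h2
      rw [h2]; exact Set.subset_univ _
    exact hasSNCWith_member_centre_of_trace_transversal hXreg hsq hθ hC hCreg hF1 hF2 hF3 h𝓕0 hT1 hT2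
  -- T23-A′ (A′-3): the special-fibre trace of the strict transform (res-L1-w45b-stub-2, slim twin)
  have hTrace : ∀ (C 𝓕 : X.IdealSheafData) (F : Set G) (hF : IsClosed F) (X₂ : Scheme.{0}) (τ : X₂ ⟶ X) (j₂ : G' ⟶ X₂)
      (t₂ : G' ⟶ Spec (.of k)), X3 F → IsProper (σ ≫ q) →
      C.comap jG = vanishingIdeal ⟨Z, hZ⟩ → Flat (C.subschemeι ≫ σ ≫ q) → Scheme.IsRegular C.subscheme →
      IsBlowup τ C → IsLocallyNoetherian X₂ → IsPullback j₂ t₂ ((τ ≫ σ) ≫ q) (Spec.map (CommRingCat.ofHom θ)) → j₂ ≫ τ = υ₂ ≫ jG →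
      𝓕.comap jG = vanishingIdeal ⟨F, hF⟩ → (∀ z : X, (stalkIdeal 𝓕 z).IsPrincipal) → Scheme.IsRegular 𝓕.subscheme →
      σ '' (𝓕.support : Set X) ⊆ {p : P | ¬ IsGenericPoint p Y} →
      (fun _ _ _ _ _ _ _ _ _ σ _ 𝓔 => Flat (𝓔.subschemeι ≫ σ ≫ q)) F₉ Z₉ hZ₉ F₁₀ υ' G γ F X σ jG 𝓕 → ¬ T ⊆ F →
      HasSNCWith [𝓕] C →
      (strictTransformIdeal τ C 𝓕).comap j₂ = vanishingIdeal (⟨closure (υ₂ ⁻¹' (F \ Z)), isClosed_closure⟩ : Closeds G') := by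
    intro C 𝓕 F hF X₂ τ j₂ t₂ hX3 _ hC hCflat _ hτ hX₂ hsq₂ hcomm hF1 _ _ _ _ _ hE
    obtain ⟨hF', hT1, hT2⟩ := hX3
    haveI := hX₂
    exact comap_strictTransformIdeal_eq_vanishingIdeal_of_transversal' hsq hθ hτ hυ₂ hcomm hsq₂ hC hCflat hT1 hT2 hF1 hE
  -- the core
  have hB := Tower.invB_pairRoundCore O k θ hθ P q Y hYirr hYcl hPnoeth hPreg Ch hChSplit hChStep _ Z₉ hZ₉ υ' hIso hRuledSt G G' γ T H KH
    (E :: Es) hH Z hZ υ₂ hυ' hZinf hTirr hTH X σ S jG tG hCh hXreg hdom hsq hTS hExcH hCand W hW hWmem hpair hZT hfull hυ₂ hKHcl hKHE hKHne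
    (hP · ·) hS hSo hBorn X3 hSNC hTrace K' E' Es' hK' hE' hEs''
  have hG'int : IsIntegral G' := hB.2.2.1
  haveI := hG'int
  -- the side facts of `K'`
  rcases hK' with rfl | ⟨-, rfl⟩
  · exact ⟨hB, isClosed_empty, Set.empty_subset _, Set.empty_ne_univ⟩
  · have hne : closure (υ₂ ⁻¹' (KH \ Z)) ≠ Set.univ :=
      closure_preimage_ne_univ υ₂ _ hυ₂ KH Z hKHcl hKHne hZ (fun h => hTZ (h ▸ Set.subset_univ _)) hZsupp.le _
        (Set.preimage_mono fun z hz => hz.1)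
    refine ⟨hB, isClosed_closure, ?_, hne⟩
    rcases hE' with rfl | rfl
    · exact closure_preimage_diff_subset_closure_diff_preimage υ₂ KH Z
    · have h := closure_preimage_diff_subset_of_isBlowup υ₂ (vanishingIdeal (⟨Z, hZ⟩ : Closeds G)) hυ₂ KH H hH hKHE
      rw [hZsupp] at h
      exact h


end Fact

end Summit.ResolutionOfSingularities.ResolutionOfSingularities.Cruxes.EquisingularLiftNat.Sections

end
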